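import Summits.QuantumFields.YangMills.Theorems.ColdStartUniversalityLatticeLangevinWilsonGeneratorPoincareApprox
import HarnessLib

/-!
# Route `ColdStartUniversality` (fixed-cut-off `L²(μ_{β'})` package): ★★ GENERATOR-FORM POINCARÉ ⇒ `L²` DECAY for the SZZ
# dynamics at EVERY `(L, β')`, UNCONDITIONALLY — the hypothesis `hEquiv` of g16 / the smoothing input `(S)` of g17 DISCHARGED

Helper file (seat `ym-line-csu-p1`, g18; `--supports stmt-QuantumFields-27363`).  For the SU(2) lattice Langevin dynamics of
Shen–Zhu–Zhu on `(ℤ/L)³` at any coupling `β'`, reversible w.r.t. the Wilson measure `μ = μ_{β'}`, and ANY realising kernel family: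

  the Poincaré inequality `λ Var_μ(F) ≤ −∫ (F − μF) 𝓛f dμ` for all `C³` cylinder functions `F = f∘coords`
  ⟹ `∫ (κ_t G − μG)² dμ ≤ e^{−2λt} Var_μ(G)` for every continuous `G` and every `t ≥ 0`.

This is Bakry–Gentil–Ledoux Thm 4.2.5 (ii)⇐(i) for this diffusion; the textbook proof needs `C³` cylinders to be a CORE (essential
self-adjointness, §3.2) or the heat equation on smooth functions.  Here: no core, no generator domain, no spectral theorem, no
hypoelliptic smoothing.  Route (all kernel-checked in the tree):
  (1) semigroup-form Poincaré ⟺ decay by convexity (`…WilsonSemigroupPoincare`, g17);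
  (2) `√𝓔_h` is a seminorm, `𝓔_h(κ_sG) ≤ Var(G)/2s`, `𝓔_h(G − κ_sG) → 0` at small scales (`…DirichletScaleSeminorm/SmallScales`);
  (3) the scale-`h` forms at `β'` and at `0` are comparable (ground-state kernel comparison, `…DirichletScaleComparison`);
  (4) at `β' = 0` the semigroup preserves the ridge class = `C³` cylinders (`…RidgeSmoothing`);
  (5) ⟹ approximation in energy by `C³` cylinders (`…WilsonEnergyApproximation`);
  (6) one approximant ⇒ one variance bound `λ Var(G) ≤ (1+t)²E + B_t ε` (`…WilsonGeneratorPoincareApprox`);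
  (7) THIS FILE: `λ Var(G) ≤ sup_h 𝓔_h(G)` for every continuous `G`, i.e. semigroup-form Poincaré, hence decay.

* ★★ `semigroupPoincare_of_generatorPoincare` — generator-form Poincaré(`λ`) on `C³` cylinders ⇒ semigroup-form Poincaré(`λ`) on `C(X)`.
* ★★ `integral_sq_transition_sub_le_exp_of_generatorPoincare` — ⇒ `L²(μ_{β'})` decay at rate `λ` for all continuous `G`.
* ★★ `generatorPoincare_implies_decay` — the statement of the hypothesis `hEquiv` of `uniformL2Gap_of_uniformPoincare` /
  `UniformColdStartMixing_of_uniformPoincare` (g16), VERBATIM, as a theorem.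

THEOREMS ONLY, no definition, no sorry.  HONEST FRAMING: RECORD-rung R3 plumbing at FIXED cut-off; the Poincaré inequality itself
(uniformly in the cut-off, in physical units) is the open problem = the crux in `L²` form; nothing K-uniform is proved; no crux,
rung or summit statement is proved; the Yang–Mills mass gap is NOT proved.
-/

set_option autoImplicit false

noncomputable section

namespace Summit.QuantumFields.YangMills.Theorems.ColdStartUniversality

open MeasureTheory ProbabilityTheory Filter Set Topology
open scoped BigOperators NNReal ENNReal
open Literature.Probability.Process Literature.MathematicalPhysics.QuantumFieldTheory
open Literature.MathematicalPhysics.QuantumLattice (fundamentalRep fundamentalLatticeRep continuous_fundamentalRep)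

variable {L : ℕ} [NeZero L]

/-! ## Generator-form Poincaré ⇒ semigroup-form Poincaré ⇒ decay -/

/-- ★★ **Generator-form Poincaré on `C³` cylinders ⇒ semigroup-form Poincaré on `C(X)`, same constant, NO smoothing hypothesis.**
If `λ Var_μ(F) ≤ −∫ (F − μF) 𝓛f dμ_{β'}` for every `C³` `f`, `F = f∘coords`, then every continuous `G` satisfies, for every `η > 0`,
`(λ − η) Var_μ(G) ≤ 𝓔_h(G)` for some `h > 0`.  Proof: if the energies `𝓔_h(G)` are unbounded there is nothing to do; otherwise let
`E = sup_h 𝓔_h(G)`; by `exists_cylinder_energy_approx` and `mul_variance_le_of_generatorPoincare_of_approx`,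
`λ Var(G) ≤ (1+t)² E + B_t ε` for all `t, ε ∈ (0,1]`, hence `λ Var(G) ≤ E`, and `(λ − η)Var(G) < E` is exceeded by some `𝓔_h(G)`.
Compare `semigroupPoincare_of_generatorPoincare_of_smoothing` (g17), whose hypothesis `(S)` is hereby removed.
[cite: BakryGentilLedoux2014, Thm 4.2.5 and §3.2] -/
theorem semigroupPoincare_of_generatorPoincare (L : ℕ) [NeZero L] (β' : ℝ)
    (κ : ℝ≥0 → Kernel (GaugeConfig 3 L (Matrix.specialUnitaryGroup (Fin 2) ℂ))
      (GaugeConfig 3 L (Matrix.specialUnitaryGroup (Fin 2) ℂ))) [∀ t, IsMarkovKernel (κ t)]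
    (hreal : ∀ (t : ℝ≥0) (x : GaugeConfig 3 L (Matrix.specialUnitaryGroup (Fin 2) ℂ))
        (Ω : Type) [MeasurableSpace Ω] (P : Measure Ω) [IsProbabilityMeasure P]
        (W : ℝ≥0 → Ω → (Edge 3 L × NoiseIdx 2 → ℝ)) (hW : IsFlatBrownian W P)
        (U : ℝ≥0 → Ω → GaugeConfig 3 L (Matrix.specialUnitaryGroup (Fin 2) ℂ)),
        (∀ ω, U 0 ω = x) →
        (latticeLangevinDynamics (fundamentalLatticeRep 2) β').IsSolution (fundamentalRep (Fin 2))
          hW.natFiltration P W U →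
        κ t x = P.map (U t))
    {lam : ℝ}
    (hPgen : ∀ (f : (Edge 3 L × Fin 2 × Fin 2 × Bool → ℝ) → ℝ), ContDiff ℝ 3 f →
        let coords : GaugeConfig 3 L (Matrix.specialUnitaryGroup (Fin 2) ℂ) → (Edge 3 L × Fin 2 × Fin 2 × Bool → ℝ) :=
          fun V q => (fun z : ℂ => if q.2.2.2 then z.im else z.re)
            ((fundamentalRep (Fin 2) (V q.1) : Matrix (Fin 2) (Fin 2) ℂ) q.2.1 q.2.2.1)
        let gen : GaugeConfig 3 L (Matrix.specialUnitaryGroup (Fin 2) ℂ) → ℝ := fun V =>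
          (∑ i : Edge 3 L × Fin 2 × Fin 2 × Bool, fderiv ℝ f (coords V) (Pi.single i 1) *
              (fun z : ℂ => if i.2.2.2 then z.im else z.re)
                ((latticeLangevinDynamics (fundamentalLatticeRep 2) β').drift
                  (matrixConfig (fundamentalRep (Fin 2)) V) i.1 i.2.1 i.2.2.1) +
          1 / 2 * ∑ i : Edge 3 L × Fin 2 × Fin 2 × Bool, ∑ j : Edge 3 L × Fin 2 × Fin 2 × Bool,
            fderiv ℝ (fun z => fderiv ℝ f z (Pi.single i 1)) (coords V) (Pi.single j 1) *
              ∑ n : Edge 3 L × NoiseIdx 2,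
                (if n.1 = i.1 then (fun z : ℂ => if i.2.2.2 then z.im else z.re)
                  ((latticeLangevinDynamics (fundamentalLatticeRep 2) β').noise
                    (matrixConfig (fundamentalRep (Fin 2)) V) i.1 n.2 i.2.1 i.2.2.1) else 0) *
                (if n.1 = j.1 then (fun z : ℂ => if j.2.2.2 then z.im else z.re)
                  ((latticeLangevinDynamics (fundamentalLatticeRep 2) β').noise
                    (matrixConfig (fundamentalRep (Fin 2)) V) j.1 n.2 j.2.1 j.2.2.1) else 0))
        lam * ∫ V, (f (coords V) - ∫ V', f (coords V') ∂(wilsonMeasure (d := 3) (L := L) (fundamentalRep (Fin 2)) β')) ^ 2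
            ∂(wilsonMeasure (d := 3) (L := L) (fundamentalRep (Fin 2)) β') ≤
          -∫ V, (f (coords V) - ∫ V', f (coords V') ∂(wilsonMeasure (d := 3) (L := L) (fundamentalRep (Fin 2)) β')) *
            gen V ∂(wilsonMeasure (d := 3) (L := L) (fundamentalRep (Fin 2)) β'))
    {G : GaugeConfig 3 L (Matrix.specialUnitaryGroup (Fin 2) ℂ) → ℝ} (hG : Continuous G) {η : ℝ} (hη : 0 < η) :
    ∃ h : ℝ≥0, 0 < h ∧
      (lam - η) * ∫ x, (G x - ∫ z, G z ∂(wilsonMeasure (d := 3) (L := L) (fundamentalRep (Fin 2)) β')) ^ 2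
          ∂(wilsonMeasure (d := 3) (L := L) (fundamentalRep (Fin 2)) β') ≤
        (h : ℝ)⁻¹ * ((∫ x, G x * G x ∂(wilsonMeasure (d := 3) (L := L) (fundamentalRep (Fin 2)) β')) -
          ∫ x, G x * (∫ y, G y ∂(κ h x)) ∂(wilsonMeasure (d := 3) (L := L) (fundamentalRep (Fin 2)) β')) := by
  classical
  haveI := secondCountableTopology_su2
  haveI := borelSpace_config L
  set μ : Measure (GaugeConfig 3 L (Matrix.specialUnitaryGroup (Fin 2) ℂ)) :=
    wilsonMeasure (d := 3) (L := L) (fundamentalRep (Fin 2)) β' with hμ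
  haveI : IsProbabilityMeasure μ :=
    isProbabilityMeasure_wilsonMeasure (d := 3) (L := L) (fundamentalRep (Fin 2)) (continuous_fundamentalRep (Fin 2)) β'
  set Vr : ℝ := ∫ x, (G x - ∫ z, G z ∂μ) ^ 2 ∂μ with hVr
  have hVr0 : 0 ≤ Vr := integral_nonneg fun x => sq_nonneg _
  -- the energies `D h = h⁻¹ Q_h(G)`
  set D : ℝ≥0 → ℝ := fun h => (h : ℝ)⁻¹ * ((∫ x, G x * G x ∂μ) - ∫ x, G x * (∫ y, G y ∂(κ h x)) ∂μ) with hD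
  -- trivial cases: `Var(G) = 0` or `λ ≤ η`
  by_cases htriv : (lam - η) * Vr ≤ 0
  · exact ⟨1, one_pos, htriv.trans (dirichletScale_nonneg L β' κ hreal 1 hG)⟩
  have hVpos : 0 < Vr := by
    rcases hVr0.lt_or_eq with h | h
    · exact h
    · exfalso; apply htriv; rw [← h, mul_zero]
  have hlam : 0 < lam := by
    by_contra hle
    exact htriv (mul_nonpos_of_nonpos_of_nonneg (by linarith) hVr0)
  -- unbounded energies: nothing to do
  by_cases hbdd : ∃ E : ℝ, ∀ h : ℝ≥0, 0 < h → D h ≤ E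
  swap
  · push Not at hbdd
    obtain ⟨h, hh, hlt⟩ := hbdd ((lam - η) * Vr)
    exact ⟨h, hh, hlt.le⟩
  -- bounded energies: the supremum `E`
  obtain ⟨E', hE'⟩ := hbdd
  set S : Set ℝ := D '' Ioi (0 : ℝ≥0) with hS
  have hne : S.Nonempty := ⟨D 1, 1, mem_Ioi.2 one_pos, rfl⟩
  have hbddS : BddAbove S := ⟨E', by rintro _ ⟨h, hh, rfl⟩; exact hE' h hh⟩
  set E : ℝ := sSup S with hEdef
  have hle : ∀ h : ℝ≥0, 0 < h → D h ≤ E := fun h hh => le_csSup hbddS ⟨h, mem_Ioi.2 hh, rfl⟩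
  have hE0 : 0 ≤ E := (dirichletScale_nonneg L β' κ hreal 1 hG).trans (hle 1 one_pos)
  -- KEY: `λ Var(G) ≤ E`
  have hkey : lam * Vr ≤ E := by
    obtain ⟨A, hA0, happrox⟩ := exists_cylinder_energy_approx L β' κ hreal hG hle
    -- for every `t ∈ (0,1]`: `λ Vr ≤ (1+t)² E`
    have ht_bound : ∀ t : ℝ, 0 < t → lam * Vr ≤ (1 + t) ^ 2 * E := by
      intro t ht
      have hBt : 0 ≤ ((1 + t) * (1 + t⁻¹) + lam * (1 + t⁻¹)) * A := by positivity
      refine le_of_forall_le_add_mul hBt fun ε hε hε1 => ?_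
      obtain ⟨f, hf, hfc, hrest⟩ := happrox ε hε hε1
      obtain ⟨hL2, h₀, hh₀, hEn⟩ := hrest
      have hFc : Continuous fun V : GaugeConfig 3 L (Matrix.specialUnitaryGroup (Fin 2) ℂ) =>
          f (fun q => (fun z : ℂ => if q.2.2.2 then z.im else z.re)
            ((fundamentalRep (Fin 2) (V q.1) : Matrix (Fin 2) (Fin 2) ℂ) q.2.1 q.2.2.1)) :=
        hf.continuous.comp (continuous_coords (L := L))
      have h := mul_variance_le_of_generatorPoincare_of_approx L β' κ hreal hlam.le hPgen hG hle
        (A := A) (ε := ε) ht hf hfc hFc (fun V => rfl) hL2 hh₀ hEn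
      calc lam * Vr ≤ (1 + t) ^ 2 * E + ((1 + t) * (1 + t⁻¹) + lam * (1 + t⁻¹)) * (A * ε) := h
        _ = (1 + t) ^ 2 * E + ((1 + t) * (1 + t⁻¹) + lam * (1 + t⁻¹)) * A * ε := by ring
    -- let `t ↓ 0`: `(1+t)² E ≤ E + 3E t` for `t ≤ 1`
    refine le_of_forall_le_add_mul (show 0 ≤ 3 * E by positivity) fun t ht ht1 => ?_
    calc lam * Vr ≤ (1 + t) ^ 2 * E := ht_bound t ht
      _ = E + (2 + t) * E * t := by ring
      _ ≤ E + 3 * E * t := by nlinarith [mul_nonneg (mul_nonneg hE0 ht.le) (sub_nonneg.2 ht1)]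
  -- conclusion: `(λ − η) Vr < E = sup`, so some energy exceeds it
  have hlt : (lam - η) * Vr < sSup S := by
    have : (lam - η) * Vr < lam * Vr := by nlinarith
    exact this.trans_le hkey
  obtain ⟨_, ⟨h, hh, rfl⟩, hDlt⟩ := exists_lt_of_lt_csSup hne hlt
  exact ⟨h, mem_Ioi.1 hh, hDlt.le⟩

/-- ★★ **Generator-form Poincaré ⇒ `L²(μ_{β'})` decay, UNCONDITIONALLY**: the Poincaré inequality with constant `1/λ` on `C³`
cylinder functions implies `∫ (κ_t G − μG)² dμ_{β'} ≤ e^{−2λt} Var_{μ_{β'}}(G)` for every realising kernel family, every continuous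
`G` and every `t` (`semigroupPoincare_of_generatorPoincare` + `integral_sq_transition_sub_le_exp_of_semigroupPoincare`).  This is
`integral_sq_transition_sub_le_exp_of_generatorPoincare_of_smoothing` (g17) with the smoothing hypothesis `(S)` REMOVED.
[cite: BakryGentilLedoux2014, Thm 4.2.5] -/
theorem integral_sq_transition_sub_le_exp_of_generatorPoincare (L : ℕ) [NeZero L] (β' : ℝ)
    (κ : ℝ≥0 → Kernel (GaugeConfig 3 L (Matrix.specialUnitaryGroup (Fin 2) ℂ))
      (GaugeConfig 3 L (Matrix.specialUnitaryGroup (Fin 2) ℂ))) [∀ t, IsMarkovKernel (κ t)]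
    (hreal : ∀ (t : ℝ≥0) (x : GaugeConfig 3 L (Matrix.specialUnitaryGroup (Fin 2) ℂ))
        (Ω : Type) [MeasurableSpace Ω] (P : Measure Ω) [IsProbabilityMeasure P]
        (W : ℝ≥0 → Ω → (Edge 3 L × NoiseIdx 2 → ℝ)) (hW : IsFlatBrownian W P)
        (U : ℝ≥0 → Ω → GaugeConfig 3 L (Matrix.specialUnitaryGroup (Fin 2) ℂ)),
        (∀ ω, U 0 ω = x) →
        (latticeLangevinDynamics (fundamentalLatticeRep 2) β').IsSolution (fundamentalRep (Fin 2))
          hW.natFiltration P W U →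
        κ t x = P.map (U t))
    {lam : ℝ}
    (hPgen : ∀ (f : (Edge 3 L × Fin 2 × Fin 2 × Bool → ℝ) → ℝ), ContDiff ℝ 3 f →
        let coords : GaugeConfig 3 L (Matrix.specialUnitaryGroup (Fin 2) ℂ) → (Edge 3 L × Fin 2 × Fin 2 × Bool → ℝ) :=
          fun V q => (fun z : ℂ => if q.2.2.2 then z.im else z.re)
            ((fundamentalRep (Fin 2) (V q.1) : Matrix (Fin 2) (Fin 2) ℂ) q.2.1 q.2.2.1)
        let gen : GaugeConfig 3 L (Matrix.specialUnitaryGroup (Fin 2) ℂ) → ℝ := fun V =>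
          (∑ i : Edge 3 L × Fin 2 × Fin 2 × Bool, fderiv ℝ f (coords V) (Pi.single i 1) *
              (fun z : ℂ => if i.2.2.2 then z.im else z.re)
                ((latticeLangevinDynamics (fundamentalLatticeRep 2) β').drift
                  (matrixConfig (fundamentalRep (Fin 2)) V) i.1 i.2.1 i.2.2.1) +
          1 / 2 * ∑ i : Edge 3 L × Fin 2 × Fin 2 × Bool, ∑ j : Edge 3 L × Fin 2 × Fin 2 × Bool,
            fderiv ℝ (fun z => fderiv ℝ f z (Pi.single i 1)) (coords V) (Pi.single j 1) *
              ∑ n : Edge 3 L × NoiseIdx 2,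
                (if n.1 = i.1 then (fun z : ℂ => if i.2.2.2 then z.im else z.re)
                  ((latticeLangevinDynamics (fundamentalLatticeRep 2) β').noise
                    (matrixConfig (fundamentalRep (Fin 2)) V) i.1 n.2 i.2.1 i.2.2.1) else 0) *
                (if n.1 = j.1 then (fun z : ℂ => if j.2.2.2 then z.im else z.re)
                  ((latticeLangevinDynamics (fundamentalLatticeRep 2) β').noise
                    (matrixConfig (fundamentalRep (Fin 2)) V) j.1 n.2 j.2.1 j.2.2.1) else 0))
        lam * ∫ V, (f (coords V) - ∫ V', f (coords V') ∂(wilsonMeasure (d := 3) (L := L) (fundamentalRep (Fin 2)) β')) ^ 2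
            ∂(wilsonMeasure (d := 3) (L := L) (fundamentalRep (Fin 2)) β') ≤
          -∫ V, (f (coords V) - ∫ V', f (coords V') ∂(wilsonMeasure (d := 3) (L := L) (fundamentalRep (Fin 2)) β')) *
            gen V ∂(wilsonMeasure (d := 3) (L := L) (fundamentalRep (Fin 2)) β'))
    {G : GaugeConfig 3 L (Matrix.specialUnitaryGroup (Fin 2) ℂ) → ℝ} (hG : Continuous G) (t : ℝ≥0) :
    ∫ x, ((∫ y, G y ∂(κ t x)) - ∫ z, G z ∂(wilsonMeasure (d := 3) (L := L) (fundamentalRep (Fin 2)) β')) ^ 2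
        ∂(wilsonMeasure (d := 3) (L := L) (fundamentalRep (Fin 2)) β') ≤
      Real.exp (-2 * lam * t) *
        ∫ x, (G x - ∫ z, G z ∂(wilsonMeasure (d := 3) (L := L) (fundamentalRep (Fin 2)) β')) ^ 2
          ∂(wilsonMeasure (d := 3) (L := L) (fundamentalRep (Fin 2)) β') :=
  integral_sq_transition_sub_le_exp_of_semigroupPoincare L β' κ hreal
    (fun _ hG' _ hη => semigroupPoincare_of_generatorPoincare L β' κ hreal hPgen hG' hη) hG t

/-- ★★ **`hEquiv` IS A THEOREM.**  The hypothesis `hEquiv` of `uniformL2Gap_of_uniformPoincare` /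
`UniformColdStartMixing_of_uniformPoincare` (g16) — «at every torus size `L`, coupling `β'` and rate `λ > 0`, the generator-form
Poincaré inequality with constant `1/λ` on `C³` cylinder functions implies the `L²(μ_{β'})` decay at rate `λ` for every realising
kernel family and every continuous observable» — stated VERBATIM and proved (`integral_sq_transition_sub_le_exp_of_generatorPoincare`).
Bakry–Gentil–Ledoux Thm 4.2.5 (i)⇒(ii) for the SU(2) lattice Langevin dynamics, with no core / essential-self-adjointness input.
[cite: BakryGentilLedoux2014, Thm 4.2.5] -/
theorem generatorPoincare_implies_decay :
    ∀ (L : ℕ) [NeZero L] (β' lam : ℝ), 0 < lam →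
      (∀ (f : (Edge 3 L × Fin 2 × Fin 2 × Bool → ℝ) → ℝ), ContDiff ℝ 3 f →
        let coords : GaugeConfig 3 L (Matrix.specialUnitaryGroup (Fin 2) ℂ) → (Edge 3 L × Fin 2 × Fin 2 × Bool → ℝ) :=
          fun V q => (fun z : ℂ => if q.2.2.2 then z.im else z.re)
            ((fundamentalRep (Fin 2) (V q.1) : Matrix (Fin 2) (Fin 2) ℂ) q.2.1 q.2.2.1)
        let gen : GaugeConfig 3 L (Matrix.specialUnitaryGroup (Fin 2) ℂ) → ℝ := fun V =>
          (∑ i : Edge 3 L × Fin 2 × Fin 2 × Bool, fderiv ℝ f (coords V) (Pi.single i 1) *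
              (fun z : ℂ => if i.2.2.2 then z.im else z.re)
                ((latticeLangevinDynamics (fundamentalLatticeRep 2) β').drift
                  (matrixConfig (fundamentalRep (Fin 2)) V) i.1 i.2.1 i.2.2.1) +
          1 / 2 * ∑ i : Edge 3 L × Fin 2 × Fin 2 × Bool, ∑ j : Edge 3 L × Fin 2 × Fin 2 × Bool,
            fderiv ℝ (fun z => fderiv ℝ f z (Pi.single i 1)) (coords V) (Pi.single j 1) *
              ∑ n : Edge 3 L × NoiseIdx 2,
                (if n.1 = i.1 then (fun z : ℂ => if i.2.2.2 then z.im else z.re)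
                  ((latticeLangevinDynamics (fundamentalLatticeRep 2) β').noise
                    (matrixConfig (fundamentalRep (Fin 2)) V) i.1 n.2 i.2.1 i.2.2.1) else 0) *
                (if n.1 = j.1 then (fun z : ℂ => if j.2.2.2 then z.im else z.re)
                  ((latticeLangevinDynamics (fundamentalLatticeRep 2) β').noise
                    (matrixConfig (fundamentalRep (Fin 2)) V) j.1 n.2 j.2.1 j.2.2.1) else 0))
        lam * ∫ V, (f (coords V) - ∫ V', f (coords V') ∂(wilsonMeasure (d := 3) (L := L) (fundamentalRep (Fin 2)) β')) ^ 2
            ∂(wilsonMeasure (d := 3) (L := L) (fundamentalRep (Fin 2)) β') ≤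
          -∫ V, (f (coords V) - ∫ V', f (coords V') ∂(wilsonMeasure (d := 3) (L := L) (fundamentalRep (Fin 2)) β')) *
            gen V ∂(wilsonMeasure (d := 3) (L := L) (fundamentalRep (Fin 2)) β')) →
      ∀ (κ : ℝ≥0 → Kernel (GaugeConfig 3 L (Matrix.specialUnitaryGroup (Fin 2) ℂ))
          (GaugeConfig 3 L (Matrix.specialUnitaryGroup (Fin 2) ℂ))) [∀ t, IsMarkovKernel (κ t)],
        (∀ (t : ℝ≥0) (x : GaugeConfig 3 L (Matrix.specialUnitaryGroup (Fin 2) ℂ))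
          (Ω : Type) [MeasurableSpace Ω] (P : Measure Ω) [IsProbabilityMeasure P]
          (W : ℝ≥0 → Ω → (Edge 3 L × NoiseIdx 2 → ℝ)) (hW : IsFlatBrownian W P)
          (U : ℝ≥0 → Ω → GaugeConfig 3 L (Matrix.specialUnitaryGroup (Fin 2) ℂ)),
          (∀ ω, U 0 ω = x) →
          (latticeLangevinDynamics (fundamentalLatticeRep 2) β').IsSolution (fundamentalRep (Fin 2))
            hW.natFiltration P W U →
          κ t x = P.map (U t)) →
        ∀ (G : GaugeConfig 3 L (Matrix.specialUnitaryGroup (Fin 2) ℂ) → ℝ), Continuous G → ∀ t : ℝ≥0,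
          ∫ x, ((∫ y, G y ∂(κ t x)) - ∫ z, G z ∂(wilsonMeasure (d := 3) (L := L) (fundamentalRep (Fin 2)) β')) ^ 2
              ∂(wilsonMeasure (d := 3) (L := L) (fundamentalRep (Fin 2)) β') ≤
            Real.exp (-2 * lam * t) *
              ∫ x, (G x - ∫ z, G z ∂(wilsonMeasure (d := 3) (L := L) (fundamentalRep (Fin 2)) β')) ^ 2
                ∂(wilsonMeasure (d := 3) (L := L) (fundamentalRep (Fin 2)) β') :=
  fun L _ β' _ _ hP κ _ hreal _ hG t => integral_sq_transition_sub_le_exp_of_generatorPoincare L β' κ hreal hP hG t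

end Summit.QuantumFields.YangMills.Theorems.ColdStartUniversality

end
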